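import Mathlib.SetTheory.Ordinal.Family
import HarnessLib

/-!
# The natural (Hessenberg–Brookfield) sum of ordinals `α ⊕ β` (Clark 2015, §1.2)

Topic `Literature/Order/Ordinal`, namespace `Literature.Order.Ordinal`.  ONE definition (`nadd α β = α ⊕ β`) and its
API, everything else PROVED; no instance, no notation (we write `nadd a b`), no named fact.  The Mathlib snapshot of
this tree has no natural operations on ordinals (no `Mathlib.SetTheory.Ordinal.NaturalOps`, no `Ordinal.nadd`); this file
supplies the notion for `Literature/Algebra/EuclideanDomain` (Clark's Product Theorem `e(R₁ × R₂) ≤ e(R₁) ⊕ e(R₂)`, the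
`TODO(general form)` of `EuclideanOrderTypeProduct.lean`).
-- TODO(general form): when the pin regains Mathlib's `Ordinal.nadd`, replace `nadd` by it (same recursion).

## Source (read at the page)

P. L. Clark, *A note on Euclidean order types*, Order **32** (2015) 157–178 [Clark2015EuclideanOrderTypes] (materialised
`paper:arxiv-1208.0977`, arXiv numbering), §1, VERBATIM.  §1.1: «A map `f : X → Y` is weakly isotone (resp. isotone) if
`x₁ ≤ x₂ ⟹ f(x₁) ≤ f(x₂)` (resp. `x₁ < x₂ ⟹ f(x₁) < f(x₂)`). … We denote by `X × Y` the Cartesian product endowed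
with the ordering `(x₁, y₁) ≤ (x₂, y₂) ⟺ x₁ ≤ x₂` and `y₁ ≤ y₂`.»  Theorem 2, proof, (iii) ⟹ (i) [Nagata85]: «We will
construct `λ_X ∈ Iso(X)` by a transfinite process … Having defined `X_β` for all `β < α`, we assign the value `α` to all
`x ∈ X ∖ X_β` such that … `x = sup Y_x`», §1.2: «for any Artinian ordered set `X`, `Iso(X)` has a bottom element.  Indeed
the map `λ_X : X → Ord` constructed in the proof of Theorem 2 is the bottom element of `Iso(X)`.  Following
[Brookfield02], we call `λ_X` the length function.  If `X` has a top element `T`, we define the length of `X` to be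
`len(X) = λ_X(T)`. … Example 1.2: For `m, n ∈ ℤ⁺`, let `X₁ = {0, …, m}` and `X₂ = {0, …, n}`, and let `X = X₁ × X₂`.
Then for all `(i, j) ∈ X`, `λ_X(i, j) = i + j` and `len(X) = m + n`.  For `α, β ∈ Ord`, we define the Brookfield sum
`α ⊕_B β := len((α + 1) × (β + 1))`. … Theorem 3. For all `α, β ∈ Ord`, `α ⊕_B β = α ⊕_H β`. Proof. See
[Brookfield02]. … we write `α ⊕ β` … and speak of the Hessenberg–Brookfield sum.  This operation is well-known to the
initiates of ordinal arithmetic, who call it the “natural sum”. … Proposition 4. Let `α, β ∈ Ord`. a) If `β < ω`, then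
`α + β = α ⊕ β`. b) In general we have `max(α + β, β + α) ≤ α ⊕ β ≤ αβ + βα`. Proof. Left to the reader.»

## What is formalised (dictionary and the declared deviation)

* `nadd a b` is DEFINED by the recursion `a ⊕ b = max (sup_{a′<a} (a′ ⊕ b + 1)) (sup_{b′<b} (a ⊕ b′ + 1))` — the
  value at `(a, b)` of the least isotone map on `Ord × Ord` (Clark's transfinite construction of `λ_X`: the value at `x`
  is the least ordinal above the values at all `y < x`; for the product order it suffices to look at `(a′, b)` and
  `(a, b′)` by isotonicity).  That this IS Brookfield's `λ` is PROVED: `nadd` is isotone on `Ord × Ord`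
  (**`nadd_strictMono`**: `p < q` in the product order `⟹ nadd p.1 p.2 < nadd q.1 q.2`) and lies below every map that is
  isotone on the rectangle `(α + 1) × (β + 1)` (**`nadd_le_of_isotone`** — «`λ_X` is the bottom element of `Iso(X)`»,
  with `len((α + 1) × (β + 1)) = λ(α, β)`); Clark's Theorem 3 (`= ⊕_H`, Cantor normal forms) is NOT formalised.
* Example 1.2 / Prop. 4 (a): **`nadd_natCast`** (`α ⊕ n = α + n` for `n < ω`), `nadd_natCast_natCast` (`m ⊕ n = m + n`);
  Prop. 4 (b), lower bound: **`add_le_nadd`** (`α + β ≤ α ⊕ β`) and `add_le_nadd'` (`β + α ≤ α ⊕ β`); the algebra used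
  on the way: `nadd_comm`, `nadd_zero`, `zero_nadd`, `nadd_succ`, `succ_nadd`, `nadd_lt_nadd_left/right`,
  `nadd_le_nadd_left/right`, `lt_nadd_iff`, `nadd_le_iff`, `le_nadd_self`, `le_nadd_self'`; and `nadd_one_omega0`
  (`1 ⊕ ω = ω + 1 ≠ 1 + ω`: the natural sum is not ordinal addition).
-- TODO(general form): Prop. 4 (b)'s upper bound `α ⊕ β ≤ αβ + βα` is not formalised (as printed it fails for `β = 0 < α`:
-- `α ⊕ 0 = α > 0`; it needs `α, β ≥ 1`), nor associativity of `⊕`.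

## Mathlib / tree search

Mathlib (this pin): `Ordinal.iSup_le`, `Ordinal.le_iSup`, `Ordinal.lt_iSup_iff` for `Small`-indexed families
(`small_Iio`), `WellFoundedLT.induction`, `Order.succ`/`Order.lt_succ_iff`/`Order.succ_le_iff`, `Ordinal.add_le_iff_of_isSuccLimit`,
`Ordinal.natCast_lt_omega0`, `Ordinal.one_add_omega0`; `blsub`/`bsup` are deprecated at this pin and are not used; `rg nadd`,
`rg NaturalOps`, `rg Hessenberg` over Mathlib → nothing.  Tree: `Literature/Algebra/EuclideanDomain/EuclideanOrderTypeProduct.lean`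
(the consumer: «TODO(general form): the upper bound `e(R × S) ≤ e(R) ⊕ e(S)` (Hessenberg–Brookfield natural sum; Mathlib has no …)»).
-/

namespace Literature.Order.Ordinal

open _root_.Ordinal _root_.Order

universe u

/-- **The natural (Hessenberg–Brookfield) sum** `α ⊕ β`, by the recursion «the least ordinal exceeding all `α′ ⊕ β`
(`α′ < α`) and all `α ⊕ β′` (`β′ < β`)» — the value at `(α, β)` of the length function (least isotone map) of
`Ord × Ord` with the product order. [cite: Clark2015EuclideanOrderTypes, §1.2 (Brookfield sum `α ⊕_B β := len((α+1) × (β+1))`)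
and Thm. 2 (construction of `λ_X`)] -/
noncomputable def nadd (a b : Ordinal.{u}) : Ordinal.{u} :=
  max (⨆ x : Set.Iio a, succ (nadd x.1 b)) (⨆ y : Set.Iio b, succ (nadd a y.1))
termination_by (a, b)
decreasing_by
  · exact Prod.Lex.left _ _ x.2
  · exact Prod.Lex.right _ y.2

/-- The defining recursion, unfolded. [cite: Clark2015EuclideanOrderTypes, §1.2 and Thm. 2] -/
theorem nadd_def (a b : Ordinal.{u}) :
    nadd a b = max (⨆ x : Set.Iio a, succ (nadd x.1 b)) (⨆ y : Set.Iio b, succ (nadd a y.1)) := by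
  rw [nadd]

/-- `c < a ⊕ b` iff `c ≤ a′ ⊕ b` for some `a′ < a` or `c ≤ a ⊕ b′` for some `b′ < b`.
[cite: Clark2015EuclideanOrderTypes, §1.2 and Thm. 2] -/
theorem lt_nadd_iff {a b c : Ordinal.{u}} :
    c < nadd a b ↔ (∃ a' < a, c ≤ nadd a' b) ∨ ∃ b' < b, c ≤ nadd a b' := by
  rw [nadd_def, lt_max_iff, Ordinal.lt_iSup_iff, Ordinal.lt_iSup_iff]
  simp only [lt_succ_iff, Subtype.exists, Set.mem_Iio, exists_prop]

/-- `a ⊕ b ≤ c` iff `a′ ⊕ b < c` for all `a′ < a` and `a ⊕ b′ < c` for all `b′ < b`.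
[cite: Clark2015EuclideanOrderTypes, §1.2 and Thm. 2] -/
theorem nadd_le_iff {a b c : Ordinal.{u}} :
    nadd a b ≤ c ↔ (∀ a' < a, nadd a' b < c) ∧ ∀ b' < b, nadd a b' < c := by
  rw [← not_lt, lt_nadd_iff]
  push Not
  rfl

/-- `⊕` is isotone in the second variable. [cite: Clark2015EuclideanOrderTypes, §1.2 («isotone»)] -/
theorem nadd_lt_nadd_left {b c : Ordinal.{u}} (h : b < c) (a : Ordinal.{u}) : nadd a b < nadd a c :=
  lt_nadd_iff.2 (Or.inr ⟨b, h, le_rfl⟩)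

/-- `⊕` is isotone in the first variable. [cite: Clark2015EuclideanOrderTypes, §1.2 («isotone»)] -/
theorem nadd_lt_nadd_right {b c : Ordinal.{u}} (h : b < c) (a : Ordinal.{u}) : nadd b a < nadd c a :=
  lt_nadd_iff.2 (Or.inl ⟨b, h, le_rfl⟩)

/-- `⊕` is weakly isotone in the second variable. [cite: Clark2015EuclideanOrderTypes, §1.2] -/
theorem nadd_le_nadd_left {b c : Ordinal.{u}} (h : b ≤ c) (a : Ordinal.{u}) : nadd a b ≤ nadd a c := by
  rcases h.lt_or_eq with h | rfl
  · exact (nadd_lt_nadd_left h a).le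
  · exact le_rfl

/-- `⊕` is weakly isotone in the first variable. [cite: Clark2015EuclideanOrderTypes, §1.2] -/
theorem nadd_le_nadd_right {b c : Ordinal.{u}} (h : b ≤ c) (a : Ordinal.{u}) : nadd b a ≤ nadd c a := by
  rcases h.lt_or_eq with h | rfl
  · exact (nadd_lt_nadd_right h a).le
  · exact le_rfl

/-- Weak isotonicity in both variables. [cite: Clark2015EuclideanOrderTypes, §1.2] -/
theorem nadd_le_nadd {a b c d : Ordinal.{u}} (h₁ : a ≤ c) (h₂ : b ≤ d) : nadd a b ≤ nadd c d :=
  (nadd_le_nadd_right h₁ b).trans (nadd_le_nadd_left h₂ c)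

/-- **`(α, β) ↦ α ⊕ β` is isotone on `Ord × Ord`** with the product order «`(x₁, y₁) ≤ (x₂, y₂) ⟺ x₁ ≤ x₂` and
`y₁ ≤ y₂`»: `p < q ⟹ ⊕ p < ⊕ q`. [cite: Clark2015EuclideanOrderTypes, §1.1–§1.2 (`λ_X ∈ Iso(X)`)] -/
theorem nadd_strictMono {p q : Ordinal.{u} × Ordinal.{u}} (h : p < q) : nadd p.1 p.2 < nadd q.1 q.2 := by
  rw [Prod.lt_iff] at h
  rcases h with ⟨h₁, h₂⟩ | ⟨h₁, h₂⟩
  · exact (nadd_lt_nadd_right h₁ _).trans_le (nadd_le_nadd_left h₂ _)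
  · exact (nadd_le_nadd_right h₁ _).trans_lt (nadd_lt_nadd_left h₂ _)

/-- **«`λ_X` is the bottom element of `Iso(X)`»** for `X = (α + 1) × (β + 1)`: `α ⊕ β ≤ f(α, β)` for every map `f` that
is isotone on the rectangle below `(α, β)` — so `α ⊕ β = len((α + 1) × (β + 1))`, Brookfield's definition.
[cite: Clark2015EuclideanOrderTypes, §1.2 (length function, Brookfield sum) and Lemma 1] -/
theorem nadd_le_of_isotone (f : Ordinal.{u} × Ordinal.{u} → Ordinal.{u}) {a b : Ordinal.{u}}
    (hf : ∀ p q : Ordinal.{u} × Ordinal.{u}, q ≤ (a, b) → p < q → f p < f q) : nadd a b ≤ f (a, b) := by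
  -- induction over the rectangle, along the recursion
  suffices H : ∀ c : Ordinal.{u}, ∀ d : Ordinal.{u}, (c, d) ≤ (a, b) → nadd c d ≤ f (c, d) from H a b le_rfl
  intro c
  induction c using WellFoundedLT.induction with
  | ind c ihc =>
    intro d
    induction d using WellFoundedLT.induction with
    | ind d ihd =>
      intro hcd
      rw [nadd_le_iff]
      constructor
      · intro c' hc'
        have hle : (c', d) ≤ (a, b) := (Prod.mk_le_mk.2 ⟨hc'.le, le_rfl⟩).trans hcd
        exact (ihc c' hc' d hle).trans_lt (hf _ _ hcd (Prod.mk_lt_mk_iff_left.2 hc'))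
      · intro d' hd'
        have hle : (c, d') ≤ (a, b) := (Prod.mk_le_mk.2 ⟨le_rfl, hd'.le⟩).trans hcd
        exact (ihd d' hd' hle).trans_lt (hf _ _ hcd (Prod.mk_lt_mk_iff_right.2 hd'))

/-- **Commutativity** `α ⊕ β = β ⊕ α` (the recursion is symmetric). [cite: Clark2015EuclideanOrderTypes, §1.2
(«Hessenberg–Brookfield sum»)] -/
theorem nadd_comm : ∀ a b : Ordinal.{u}, nadd a b = nadd b a := by
  intro a
  induction a using WellFoundedLT.induction with
  | ind a iha =>
    intro b
    induction b using WellFoundedLT.induction with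
    | ind b ihb =>
      refine le_antisymm (nadd_le_iff.2 ⟨fun a' ha' ↦ ?_, fun b' hb' ↦ ?_⟩)
        (nadd_le_iff.2 ⟨fun b' hb' ↦ ?_, fun a' ha' ↦ ?_⟩)
      · rw [iha a' ha']; exact nadd_lt_nadd_left ha' b
      · rw [ihb b' hb']; exact nadd_lt_nadd_right hb' a
      · rw [← ihb b' hb']; exact nadd_lt_nadd_left hb' a
      · rw [← iha a' ha']; exact nadd_lt_nadd_right ha' b

/-- `α ⊕ 0 = α`. [cite: Clark2015EuclideanOrderTypes, Prop. 4 (a) (`β = 0`)] -/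
theorem nadd_zero : ∀ a : Ordinal.{u}, nadd a 0 = a := by
  intro a
  induction a using WellFoundedLT.induction with
  | ind a ih =>
    refine le_antisymm (nadd_le_iff.2 ⟨fun a' ha' ↦ by rw [ih a' ha']; exact ha', fun b' hb' ↦ ?_⟩) ?_
    · exact absurd hb' (not_lt_of_ge bot_le)
    · by_contra hlt
      rw [not_le] at hlt
      have h := nadd_lt_nadd_right hlt (0 : Ordinal.{u})
      rw [ih _ hlt] at h
      exact lt_irrefl _ h

/-- `0 ⊕ α = α`. [cite: Clark2015EuclideanOrderTypes, Prop. 4 (a)] -/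
theorem zero_nadd (a : Ordinal.{u}) : nadd 0 a = a := by
  rw [nadd_comm, nadd_zero]

/-- `α ⊕ (β + 1) = (α ⊕ β) + 1`. [cite: Clark2015EuclideanOrderTypes, Prop. 4 (a) (proof by induction on `β < ω`)] -/
theorem nadd_succ : ∀ a b : Ordinal.{u}, nadd a (succ b) = succ (nadd a b) := by
  intro a
  induction a using WellFoundedLT.induction with
  | ind a ih =>
    intro b
    refine le_antisymm (nadd_le_iff.2 ⟨fun a' ha' ↦ ?_, fun b' hb' ↦ ?_⟩)
      (succ_le_iff.2 (nadd_lt_nadd_left (lt_succ b) a))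
    · rw [ih a' ha']
      exact succ_lt_succ (nadd_lt_nadd_right ha' b)
    · exact (nadd_le_nadd_left (lt_succ_iff.1 hb') a).trans_lt (lt_succ _)

/-- `(α + 1) ⊕ β = (α ⊕ β) + 1`. [cite: Clark2015EuclideanOrderTypes, Prop. 4 (a)] -/
theorem succ_nadd (a b : Ordinal.{u}) : nadd (succ a) b = succ (nadd a b) := by
  rw [nadd_comm, nadd_succ, nadd_comm]

/-- `α ⊕ (β + 1) = (α ⊕ β) + 1` with `+ 1`. [cite: Clark2015EuclideanOrderTypes, Prop. 4 (a)] -/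
theorem nadd_add_one (a b : Ordinal.{u}) : nadd a (b + 1) = nadd a b + 1 := by
  rw [← succ_eq_add_one, nadd_succ, succ_eq_add_one]

/-- **Proposition 4 (a)** «If `β < ω`, then `α + β = α ⊕ β`»: `α ⊕ n = α + n` for every natural number `n`.
[cite: Clark2015EuclideanOrderTypes, Prop. 4 (a)] -/
theorem nadd_natCast (a : Ordinal.{u}) : ∀ n : ℕ, nadd a n = a + n
  | 0 => by rw [Nat.cast_zero, nadd_zero, add_zero]
  | n + 1 => by rw [Nat.cast_succ, nadd_add_one, nadd_natCast a n, add_assoc]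

/-- Proposition 4 (a), stated with `β < ω`. [cite: Clark2015EuclideanOrderTypes, Prop. 4 (a)] -/
theorem nadd_eq_add_of_lt_omega0 (a : Ordinal.{u}) {b : Ordinal.{u}} (hb : b < ω) : nadd a b = a + b := by
  obtain ⟨n, rfl⟩ := Ordinal.lt_omega0.1 hb
  exact nadd_natCast a n

/-- `n ⊕ α = n + α`?  No — `n ⊕ α = α + n` (commutativity): e.g. `1 ⊕ ω = ω + 1`. [cite: Clark2015EuclideanOrderTypes,
Prop. 4 (a), (b)] -/
theorem natCast_nadd (n : ℕ) (a : Ordinal.{u}) : nadd n a = a + n := by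
  rw [nadd_comm, nadd_natCast]

/-- **Example 1.2** «for all `(i, j) ∈ X`, `λ_X(i, j) = i + j` and `len(X) = m + n`»: on natural numbers the natural sum
is the sum. [cite: Clark2015EuclideanOrderTypes, §1.2 Example 1.2] -/
theorem nadd_natCast_natCast (m n : ℕ) : nadd (m : Ordinal.{u}) n = (m + n : ℕ) := by
  rw [nadd_natCast, Nat.cast_add]

/-- **Proposition 4 (b), lower bound** «`max(α + β, β + α) ≤ α ⊕ β`», first half: `α + β ≤ α ⊕ β` (induction on `β`:
at limits `α + β = sup_{β′<β} (α + β′)`). [cite: Clark2015EuclideanOrderTypes, Prop. 4 (b)] -/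
theorem add_le_nadd (a : Ordinal.{u}) : ∀ b : Ordinal.{u}, a + b ≤ nadd a b := by
  intro b
  induction b using Ordinal.limitRecOn with
  | zero => rw [add_zero, nadd_zero]
  | add_one b ih =>
    rw [nadd_add_one, ← add_assoc]
    exact add_le_add ih le_rfl
  | limit b hb ih =>
    rw [Ordinal.add_le_iff_of_isSuccLimit hb]
    intro c hc
    exact ((ih c hc).trans_lt (nadd_lt_nadd_left hc a)).le

/-- Proposition 4 (b), lower bound, second half: `β + α ≤ α ⊕ β`. [cite: Clark2015EuclideanOrderTypes, Prop. 4 (b)] -/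
theorem add_le_nadd' (a b : Ordinal.{u}) : b + a ≤ nadd a b := by
  rw [nadd_comm]
  exact add_le_nadd b a

/-- Proposition 4 (b), lower bound, as printed: `max(α + β, β + α) ≤ α ⊕ β`. [cite: Clark2015EuclideanOrderTypes, Prop. 4 (b)] -/
theorem max_add_le_nadd (a b : Ordinal.{u}) : max (a + b) (b + a) ≤ nadd a b :=
  max_le (add_le_nadd a b) (add_le_nadd' a b)

/-- `α ≤ α ⊕ β`. [cite: Clark2015EuclideanOrderTypes, Prop. 4 (b)] -/
theorem le_nadd_self (a b : Ordinal.{u}) : a ≤ nadd a b :=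
  le_self_add.trans (add_le_nadd a b)

/-- `β ≤ α ⊕ β`. [cite: Clark2015EuclideanOrderTypes, Prop. 4 (b)] -/
theorem le_nadd_self' (a b : Ordinal.{u}) : b ≤ nadd a b :=
  le_self_add.trans (add_le_nadd' a b)

/-- `α ⊕ β = 0 ⟺ α = 0 ∧ β = 0`. [cite: Clark2015EuclideanOrderTypes, Prop. 4 (b)] -/
theorem nadd_eq_zero_iff {a b : Ordinal.{u}} : nadd a b = 0 ↔ a = 0 ∧ b = 0 := by
  constructor
  · intro h
    have ha := le_nadd_self a b
    have hb := le_nadd_self' a b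
    rw [h] at ha hb
    exact ⟨nonpos_iff_eq_zero.1 ha, nonpos_iff_eq_zero.1 hb⟩
  · rintro ⟨rfl, rfl⟩
    exact nadd_zero 0

/-- The natural sum is not ordinal addition: `1 ⊕ ω = ω + 1`, whereas `1 + ω = ω` («there is a penalty to pay for
employing the “usual” ordinal operations rather than the Hessenberg–Brookfield sum», Remark 2.7).
[cite: Clark2015EuclideanOrderTypes, Prop. 4 (b) and Remark 2.7] -/
theorem nadd_one_omega0 : nadd (1 : Ordinal.{u}) ω = ω + 1 ∧ (1 : Ordinal.{u}) + ω = ω := by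
  refine ⟨?_, Ordinal.one_add_omega0⟩
  have h := natCast_nadd 1 (ω : Ordinal.{u})
  rw [Nat.cast_one] at h
  exact h

end Literature.Order.Ordinal
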